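import Literature.AlgebraicGeometry.HodgeTheory.RealMultiplicationDivisorClasses
import Literature.AlgebraicGeometry.HodgeTheory.WeilClassesDescendingOfLefschetzOneOne
import HarnessLib

/-!
# Tensor invariants killed by `⊕_τ 𝔰𝔩(V_τ)` at the `A`-places only: the relative first fundamental theorem `(M ⊗ N)^{𝔤 ⊗ 1} = M^{𝔤} ⊗ N` evaluated in cohomology — divisor classes cup monomials (Lombardo 2016 Lemma 3.4 / Moonen–Zarhin 1999 (3.1); Hazama 1983 §3; Goodman–Wallach §4.1.1)

Family `hodge`, layer `Literature/AlgebraicGeometry/HodgeTheory`. Research context: cell `pub-hodge-ring2`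
(HONEST FRAMING: research route conditional on HC_CM; not a corollary; Q11.4-sentence-2 already refuted in
dim ≥ 3), Literature lane, programme R4 («RM × CM»: Lombardo 2016 Lemma 3.4, «`H(A × B) ≅ H(A) × H(B)`,
`H(B)` a torus», with Moonen–Zarhin 1999 §3 (3.1): the Hodge ring of the product is generated by the classes
coming from the factors). UNCONDITIONAL; theorems only, no named fact; no step towards a summit statement.

THE STEP FORMALISED HERE (evaluation of partially invariant tensors). In the word model of the tree
(`AbelianVarietySlotsWordModel`, `RealMultiplicationDivisorClasses`) let the letters of an abelian variety `X`
be two-sorted: `A`-letters `f₁^*(g_j^* ρ(b_τ^r))` indexed by `((j, inl τ), r)` — pull-backs along `f₁ : X → B`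
of the letters of an abelian variety `B` with maps `g_j : B → A` and block bases `b_τ` of `H¹(A) ⊗ ℂ` whose
crossed classes `ρ(b_τ^0) ⌣ ρ(b_τ^1)` are combinations of rational `(1,1)`-classes — and `C`-letters
`f₂^*(y_{(j,i)}^r)` indexed by `((j, inr i), r)`, pull-backs along `f₂ : X → Z` of arbitrary degree-one
classes of an abelian variety `Z`. MAIN THEOREM `wordEval_mem_span_divisor_cup_monomial`: if a coefficient
function `a` is killed, slice by slice along slot-and-place words, by `E₀₁` and `h` placed at the positions of
every `A`-place `inl τ` (NO condition at the `C`-places), then `∑_w a(w) · x_w` lies in the `ℂ`-span of the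
classes `f₁^* d ⌣ f₂^* μ` with `d ∈ D^{p'}(B) ⊗ ℂ` (the complexified divisor ring, `divisorClassesSpan`) and
`μ = y_{l₁} ⌣ ⋯ ⌣ y_{l_r}` a monomial in the `C`-letters, `2p' + r = 2p`.

PROOF (Goodman–Wallach §4.1.1 «`(M ⊗ N)^{𝔤 ⊗ 1} = M^{𝔤} ⊗ N`», the tree's `BlockwiseSl2Invariants` §4).
Slot-and-place word by slot-and-place word (`wordEval_eq_sum_wordSlice`): split the positions into the
`A`-positions (block) and the `C`-positions (complement), `φ : Fin 2p ≃ Fin m ⊕ Fin r` (`exists_leftSplit`);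
the operator of an `A`-place is a position-dependent block family (`colourOp_inl_eq_blockFamilyAt`), so every
block slice of the slice is killed colourwise (`wordDerAt_blockFamilyAt_eq_zero_iff`); the slice is the sum
of its block slices glued with the indicator tensors of the complement words (`eq_sum_glueTensor_blockSlice`),
and the evaluation of such a glued tensor is, up to the sign of the shuffle `φ`, the cup product of the
evaluation of the block slice on the `A`-letters with the monomial of the complement word in the `C`-letters
(`cupPowOne_sumElim_eq_sign_smul_cupProduct`: the iterated product is alternating, `cupPowOne_eq_cupProduct_split`;
pull-backs are multiplicative, `complexBetti_map_cupPowOne`). If `m` is odd the block slices vanish (no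
`h`-balanced words, `eq_zero_of_colourwise_diag_of_odd`); if `m = 2p'` the evaluation of a colourwise-killed
block slice on the `A`-letters lies in `D^{p'}(B) ⊗ ℂ` by the colourwise first fundamental theorem for `SL₂`
and the crossed classes (`sum_smul_cupPowOneAlt_rmLetters_mem_divisorClassesSpan`, the per-word form of the
tree's `wordEval_rmLetters_mem_divisorClassesSpan_of_colourwise`, Hazama 1983 §3).

The input coefficient functions are produced by `RealSl2BlocksTimesCMInvariance`
(`AVSlots.exists_coeff_killed_at_real_places_of_prod_cmType`: `X` with slots over `A × C`, `A` with real
`𝔰𝔩₂`-block data, `C` of CM type); the two files are combined in `RealSl2BlocksTimesCMProductSpan`.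

## References

* [Lombardo2016] D. Lombardo, Ann. Inst. Fourier 66 (2016), Lemma 3.4 (p. 1229). [cite: Lombardo2016, Lemma 3.4 (p. 1229)]
* [MoonenZarhin1999LowDim] B. Moonen, Yu. Zarhin, Math. Ann. 315 (1999), §3 (3.1). [cite: MoonenZarhin1999LowDim, §3 (3.1)]
* [Hazama1983] F. Hazama, Tôhoku Math. J. 35 (1983), Thm. (1.1), §3 pp. 305–306. [cite: Hazama1983, §3 (pp. 305–306)]
* [GoodmanWallachGTM255] R. Goodman, N. R. Wallach, GTM 255, §4.1.1 and Thm. 5.3.3. [cite: GoodmanWallachGTM255, §4.1.1]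
* [HatcherAT2002] A. Hatcher, *Algebraic Topology* (2002), §3.2 Prop. 3.10 and p. 211. [cite: HatcherAT2002, §3.2 Prop. 3.10]
* [FultonYoungTableaux1997] W. Fulton, *Young Tableaux* (1997), §8.1. [cite: FultonYoungTableaux1997, §8.1]
-/

noncomputable section

open scoped TensorProduct
open CategoryTheory Module

namespace Literature.AlgebraicGeometry.HodgeTheory

open Literature.AlgebraicTopology.SingularHomology
open Literature.AlgebraicGeometry.Motives (IsSmoothProjective AbelianVariety bettiCohomology
  ofRatClassBaseChange)
open Literature.Barriers.HodgeConjecture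
open Literature.RepresentationTheory.GeneralLinear
open Literature.NumberTheory.DiophantineGeometry

/-! ### §1 Word model: glued indicator tensors, two-sorted colourings, the left/right split of the positions -/

section Words

variable {K : Type*} [CommRing K] {N d m r : ℕ} (φ : Fin d ≃ Fin m ⊕ Fin r)

/-- **Evaluating a block tensor glued with the indicator of a complement word**:
`∑_ε (c₁ ⊗ δ_η)(ε) · f(ε) = ∑_{ε₁} c₁(ε₁) · f(glue ε₁ η)`. [cite: FultonYoungTableaux1997, §8.1] -/
theorem sum_glueTensor_single_smul {M : Type*} [AddCommGroup M] [Module K M] (c₁ : Word N m → K)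
    (η : Word N r) (f : Word N d → M) :
    ∑ ε, glueTensor φ c₁ (Pi.single η 1) ε • f ε = ∑ ε₁, c₁ ε₁ • f (glueWord φ ε₁ η) := by
  classical
  rw [← (splitWordEquiv φ).symm.sum_comp, Fintype.sum_prod_type]
  refine Finset.sum_congr rfl fun ε₁ _ => ?_
  simp only [splitWordEquiv_symm_apply, glueTensor_glueWord]
  rw [Finset.sum_eq_single η]
  · rw [Pi.single_eq_same, mul_one]
  · intro η' _ hη'
    rw [Pi.single_eq_of_ne hη', mul_zero, zero_smul]
  · exact fun h => absurd (Finset.mem_univ _) h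

variable {T P : Type*}

/-- **The operator of an `A`-place is a position-dependent block family** for the split
`φ : positions ≃ A-positions ⊕ C-positions`: `0 × ⋯ × Y × ⋯ × 0` (the matrix `Y` at the positions of the
`A`-place `inl τ`) is `(Y at the block positions of colour τ) ⊕ 0`. [cite: GoodmanWallachGTM255, §4.1.1] -/
theorem colourOp_inl_eq_blockFamilyAt {K : Type*} [Field K] [DecidableEq T] [DecidableEq P]
    (col : Fin d → T ⊕ P) (τA : Fin m → T)
    (hA : ∀ a, col (φ.symm (Sum.inl a)) = Sum.inl (τA a))
    (hC : ∀ b τ, col (φ.symm (Sum.inr b)) ≠ Sum.inl τ) (τ : T) (Y : Matrix (Fin 2) (Fin 2) K) :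
    colourOp K col (Sum.inl τ) Y = blockFamilyAt K φ (colourOp K τA τ Y) := by
  funext q
  obtain ⟨w, rfl⟩ := φ.symm.surjective q
  rcases w with a | b
  · rw [blockFamilyAt_inl, colourOp_apply, colourOp_apply, hA]
    by_cases h : τA a = τ
    · rw [if_pos (by rw [h]), if_pos h]
    · rw [if_neg (fun h' => h (Sum.inl_injective h')), if_neg h]
  · rw [blockFamilyAt_inr, colourOp_apply, if_neg (hC b τ)]

/-- **A block of ODD size killed colourwise by `h` carries only the zero tensor**: if `h = diag(1,-1)` placed
at the positions of colour `τ` kills `c` for every colour `τ` of the block, then `c = 0` (the sum over the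
colours of these families is the constant family `h`, which has no balanced word on an odd block).
[cite: GoodmanWallachGTM255, §2.3.1 (2.16) and §4.1.1] -/
theorem eq_zero_of_colourwise_diag_of_odd {K : Type*} [Field K] [CharZero K] [Fintype T] [DecidableEq T] (hm : Odd m)
    (τA : Fin m → T) {c : Word 2 m → K}
    (hH : ∀ τ, wordDerAt K (colourOp K τA τ (Matrix.diagonal ![(1 : K), -1])) c = 0) : c = 0 := by
  refine eq_zero_of_wordDer_diag_eq_zero_of_odd K hm ?_
  rw [← wordDerAt_const]
  have hfam : (fun _ : Fin m => Matrix.diagonal ![(1 : K), -1]) =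
      ∑ τ, colourOp K τA τ (Matrix.diagonal ![(1 : K), -1]) := by
    funext q
    rw [Finset.sum_apply]
    simp only [colourOp_apply, Finset.sum_ite_eq, Finset.mem_univ, if_true]
  rw [hfam, wordDerAt_sum]
  exact Finset.sum_eq_zero fun τ _ => hH τ

/-- **The left/right split of the positions of a two-sorted colouring**: for `col : positions → T ⊕ P` with
`m` positions coloured in `T` and `r` in `P`, a bijection `positions ≃ Fin m ⊕ Fin r` under which the block
positions carry `T`-colours `τA` and the complement positions carry `P`-colours `iC` (the splitting of
the tensor positions into the factor acted on and its complement, Goodman–Wallach §4.1.1).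
[cite: GoodmanWallachGTM255, §4.1.1] -/
theorem exists_leftSplit (col : Fin d → T ⊕ P) (hm : Fintype.card {t // (col t).isLeft = true} = m)
    (hr : Fintype.card {t // ¬ (col t).isLeft = true} = r) :
    ∃ (φ : Fin d ≃ Fin m ⊕ Fin r) (τA : Fin m → T) (iC : Fin r → P),
      (∀ a, col (φ.symm (Sum.inl a)) = Sum.inl (τA a)) ∧ (∀ b, col (φ.symm (Sum.inr b)) = Sum.inr (iC b)) := by
  classical
  let φ : Fin d ≃ Fin m ⊕ Fin r := (Equiv.sumCompl fun t => (col t).isLeft = true).symm.trans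
    ((Fintype.equivFinOfCardEq hm).sumCongr (Fintype.equivFinOfCardEq hr))
  have hl : ∀ a, (col (φ.symm (Sum.inl a))).isLeft = true := fun a => by
    simp only [φ, Equiv.symm_trans_apply, Equiv.symm_symm, Equiv.sumCongr_symm, Equiv.sumCongr_apply,
      Sum.map_inl, Equiv.sumCompl_apply_inl]
    exact ((Fintype.equivFinOfCardEq hm).symm a).2
  have hr' : ∀ b, ¬ (col (φ.symm (Sum.inr b))).isLeft = true := fun b => by
    simp only [φ, Equiv.symm_trans_apply, Equiv.symm_symm, Equiv.sumCongr_symm, Equiv.sumCongr_apply,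
      Sum.map_inr, Equiv.sumCompl_apply_inr]
    exact ((Fintype.equivFinOfCardEq hr).symm b).2
  have hA : ∀ a, ∃ τ, col (φ.symm (Sum.inl a)) = Sum.inl τ := fun a => by
    have h := hl a
    rcases hca : col (φ.symm (Sum.inl a)) with τ | i
    · exact ⟨τ, rfl⟩
    · rw [hca] at h; exact absurd h (by simp)
  have hC : ∀ b, ∃ i, col (φ.symm (Sum.inr b)) = Sum.inr i := fun b => by
    have h := hr' b
    rcases hcb : col (φ.symm (Sum.inr b)) with τ | i
    · rw [hcb] at h; exact absurd (by simp) h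
    · exact ⟨i, rfl⟩
  choose τA hτA using hA
  choose iC hiC using hC
  exact ⟨φ, τA, iC, hτA, hiC⟩

/-- The two cardinalities of a left/right split add up to the number of positions. [folklore] -/
private theorem card_isLeft_add_card_not_isLeft (col : Fin d → T ⊕ P) :
    Fintype.card {t // (col t).isLeft = true} + Fintype.card {t // ¬ (col t).isLeft = true} = d := by
  classical
  rw [Fintype.card_subtype_compl, Nat.add_sub_cancel' (Fintype.card_subtype_le _), Fintype.card_fin]

end Words

/-! ### §2 Iterated cup products of two-sorted families: the shuffle sign -/

section CupPowers

variable (R : Type*) [CommRing R] [Invertible (2 : R)] {Y : Type*} [TopologicalSpace Y] {d m r : ℕ}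

/-- **Shuffling an iterated product of degree-one classes**: for a split `φ : Fin d ≃ Fin m ⊕ Fin r`
(`m + r = d`) and families `v_A`, `v_C` of degree-one classes, the iterated cup product of the family
`t ↦ (v_A ⊕ v_C)(φ t)` is `sgn(φ) · (v_A,0 ⌣ ⋯ ⌣ v_A,m-1) ⌣ (v_C,0 ⌣ ⋯ ⌣ v_C,r-1)`, `sgn(φ)` the sign of the
shuffle `positions ≃ Fin m ⊕ Fin r ≃ Fin (m + r)` (the iterated product is ALTERNATING, Hatcher Prop. 3.10 /
graded commutativity; then associativity, the tree's `cupPowOne_eq_cupProduct_split`).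
[cite: HatcherAT2002, §3.2 Prop. 3.10 and p. 211] -/
theorem cupPowOne_sumElim_eq_sign_smul_cupProduct (φ : Fin d ≃ Fin m ⊕ Fin r) (hmr : m + r = d)
    (vA : Fin m → singularCohomology R R Y 1) (vC : Fin r → singularCohomology R R Y 1) :
    cupPowOne R Y d (fun t => Sum.elim vA vC (φ t)) =
      (((Equiv.Perm.sign (φ.trans (finSumFinEquiv.trans (finCongr hmr))) : ℤˣ) : ℤ) : R) •
        cupProduct hmr (cupPowOne R Y m vA) (cupPowOne R Y r vC) := by
  classical
  set σ : Equiv.Perm (Fin d) := φ.trans (finSumFinEquiv.trans (finCongr hmr)) with hσ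
  set w : Fin d → singularCohomology R R Y 1 := fun i => Fin.append vA vC (Fin.cast hmr.symm i) with hw
  have hvw : (fun t => Sum.elim vA vC (φ t)) = w ∘ σ := by
    funext t
    obtain ⟨s, rfl⟩ := φ.symm.surjective t
    rw [Function.comp_apply, hσ, Equiv.trans_apply, Equiv.trans_apply, Equiv.apply_symm_apply, hw]
    rcases s with a | b
    · simp only [Sum.elim_inl, finSumFinEquiv_apply_left, finCongr_apply]
      rw [show Fin.cast hmr.symm (Fin.cast hmr (Fin.castAdd r a)) = Fin.castAdd r a from Fin.ext rfl,
        Fin.append_left]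
    · simp only [Sum.elim_inr, finSumFinEquiv_apply_right, finCongr_apply]
      rw [show Fin.cast hmr.symm (Fin.cast hmr (Fin.natAdd m b)) = Fin.natAdd m b from Fin.ext rfl,
        Fin.append_right]
  have hwA : (fun i : Fin m => w (Fin.cast hmr (Fin.castAdd r i))) = vA := by
    funext a
    rw [hw]
    change Fin.append vA vC (Fin.cast hmr.symm (Fin.cast hmr (Fin.castAdd r a))) = vA a
    rw [show Fin.cast hmr.symm (Fin.cast hmr (Fin.castAdd r a)) = Fin.castAdd r a from Fin.ext rfl,
      Fin.append_left]
  have hwC : (fun j : Fin r => w (Fin.cast hmr (Fin.natAdd m j))) = vC := by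
    funext b
    rw [hw]
    change Fin.append vA vC (Fin.cast hmr.symm (Fin.cast hmr (Fin.natAdd m b))) = vC b
    rw [show Fin.cast hmr.symm (Fin.cast hmr (Fin.natAdd m b)) = Fin.natAdd m b from Fin.ext rfl,
      Fin.append_right]
  rw [hvw, ← cupPowOneAlt_apply, AlternatingMap.map_perm, cupPowOneAlt_apply, Units.smul_def,
    ← Int.cast_smul_eq_zsmul R, cupPowOne_eq_cupProduct_split R m r hmr w, hwA, hwC]

end CupPowers

/-! ### §3 Evaluation: colourwise-killed block slices on the `A`-letters give divisor classes; the main theorem -/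

section Evaluation

variable {A B Z X : AbelianVariety ℂ} {n : ℕ}

/-- **(Per slot-and-place word) the evaluation of a tensor killed colourwise by `E₀₁` and `h` on the letters
`g_j^* ρ(b_τ^r)` lies in `Dᵖ'(B) ⊗ ℂ`** — the per-word form of the tree's
`wordEval_rmLetters_mem_divisorClassesSpan_of_colourwise` (colourwise first fundamental theorem for `SL₂`,
`mem_span_pairingTensor_of_colourwise`; evaluations of monochromatic pairing tensors,
`sum_pairingTensor_smul_rmLetters_mem`). [cite: Hazama1983, Thm. (1.1) and §3 (pp. 305–306)]
[cite: GoodmanWallachGTM255, §4.1.1 and Thm. 5.3.3] -/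
theorem sum_smul_cupPowOneAlt_rmLetters_mem_divisorClassesSpan (g : Fin n → (B ⟶ A)) {T : Type*}
    [DecidableEq T] [Fintype T] {W : T → Submodule ℂ (ℂ ⊗[ℚ] bettiCohomology A.X 1)}
    (b : ∀ τ, Module.Basis (Fin 2) ℂ (W τ))
    (hθ : ∀ τ, cupH1 A (b τ 0 : ℂ ⊗[ℚ] bettiCohomology A.X 1) (b τ 1) ∈
      Submodule.span ℂ {c : complexBetti A.X 2 | IsRationalClass c ∧ IsOfHodgeType A.dim A.X 2 1 1 c})
    {p' : ℕ} (u : Fin (2 * p') → Fin n × T) (s : Word 2 (2 * p') → ℂ)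
    (hE : ∀ τ, wordDerAt ℂ (colourOp ℂ (fun t => (u t).2) τ (Matrix.single 0 1 (1 : ℂ))) s = 0)
    (hH : ∀ τ, wordDerAt ℂ (colourOp ℂ (fun t => (u t).2) τ (Matrix.diagonal ![(1 : ℂ), -1])) s = 0) :
    ∑ ε : Word 2 (2 * p'), s ε •
        cupPowOneAlt ℂ (Motives.ComplexPoints B.X) (2 * p') (fun t => rmLetters g b (u t, ε t)) ∈
      divisorClassesSpan B.X B.dim p' := by
  classical
  have hslice := mem_span_pairingTensor_of_colourwise (K := ℂ) p' (fun t => (u t).2) s hE hH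
  set L : (Word 2 (2 * p') → ℂ) →ₗ[ℂ] complexBetti B.X (2 * p') :=
    Fintype.linearCombination ℂ (fun ε : Word 2 (2 * p') =>
      cupPowOneAlt ℂ (Motives.ComplexPoints B.X) (2 * p') (fun t => rmLetters g b (u t, ε t))) with hL
  have hLapply : ∀ c' : Word 2 (2 * p') → ℂ, L c' = ∑ ε, c' ε •
      cupPowOneAlt ℂ (Motives.ComplexPoints B.X) (2 * p') (fun t => rmLetters g b (u t, ε t)) :=
    fun c' => Fintype.linearCombination_apply ℂ _ c'
  rw [← hLapply]
  have hle : Submodule.span ℂ (Set.range fun e : {e : Fin (2 * p') ≃ Fin 2 × Fin p' //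
      ∀ c, (u (e.symm (0, c))).2 = (u (e.symm (1, c))).2} => pairingTensor ℂ e.1) ≤
      (divisorClassesSpan B.X B.dim p').comap L := by
    refine Submodule.span_le.2 ?_
    rintro _ ⟨e, rfl⟩
    change L (pairingTensor ℂ e.1) ∈ divisorClassesSpan B.X B.dim p'
    rw [hLapply]
    exact sum_pairingTensor_smul_rmLetters_mem g b hθ u e.1 e.2
  exact hle hslice

/-- **MAIN THEOREM (evaluation of tensors killed by `⊕_τ 𝔰𝔩(V_τ)` at the `A`-places only).** Let the
letters of `X` be the `A`-letters `f₁^*(g_j^* ρ(b_τ^r))`, `((j, inl τ), r)`, and the `C`-letters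
`f₂^*(y_{(j,i)}^r)`, `((j, inr i), r)`, with `b_τ` block bases of `H¹(A) ⊗ ℂ` whose crossed classes
`ρ(b_τ^0) ⌣ ρ(b_τ^1)` are combinations of rational `(1,1)`-classes. If a coefficient function `a` on words of
length `2p` is killed, slice by slice along slot-and-place words, by `E₀₁` and `h` placed at the positions of
every `A`-place, then `∑_w a(w) · x_w` is a `ℂ`-combination of classes `f₁^* d ⌣ f₂^*(y_{l₁} ⌣ ⋯ ⌣ y_{l_r})`
with `d ∈ D^{p'}(B) ⊗ ℂ` and `2p' + r = 2p` — the invariants of `H(A) × (torus)` are (divisor classes) ⊗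
(everything): Goodman–Wallach «`(M ⊗ N)^{𝔤 ⊗ 1} = M^{𝔤} ⊗ N`» with Hazama's first fundamental theorem on the
first factor. [cite: Lombardo2016, Lemma 3.4 (p. 1229)] [cite: MoonenZarhin1999LowDim, §3 (3.1)]
[cite: Hazama1983, Thm. (1.1) and §3 (pp. 305–306)] [cite: GoodmanWallachGTM255, §4.1.1 and Thm. 5.3.3] -/
theorem wordEval_mem_span_divisor_cup_monomial (f₁ : X ⟶ B) (f₂ : X ⟶ Z) (g : Fin n → (B ⟶ A))
    {T : Type*} [Fintype T] [DecidableEq T] {W : T → Submodule ℂ (ℂ ⊗[ℚ] bettiCohomology A.X 1)}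
    (b : ∀ τ, Module.Basis (Fin 2) ℂ (W τ))
    (hθ : ∀ τ, cupH1 A (b τ 0 : ℂ ⊗[ℚ] bettiCohomology A.X 1) (b τ 1) ∈
      Submodule.span ℂ {c : complexBetti A.X 2 | IsRationalClass c ∧ IsOfHodgeType A.dim A.X 2 1 1 c})
    {P : Type*} [Fintype P] [DecidableEq P] (y : (Fin n × P) × Fin 2 → complexBetti Z.X 1)
    {p : ℕ} {a : (Fin (2 * p) → (Fin n × (T ⊕ P)) × Fin 2) → ℂ}
    (hEa : ∀ (U : Fin (2 * p) → Fin n × (T ⊕ P)) (τ : T),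
      wordDerAt ℂ (colourOp ℂ (fun t => (U t).2) (Sum.inl τ) (Matrix.single 0 1 (1 : ℂ))) (wordSlice a U) = 0)
    (hHa : ∀ (U : Fin (2 * p) → Fin n × (T ⊕ P)) (τ : T),
      wordDerAt ℂ (colourOp ℂ (fun t => (U t).2) (Sum.inl τ) (Matrix.diagonal ![(1 : ℂ), -1]))
        (wordSlice a U) = 0) :
    wordEval (cupPowOneAlt ℂ (Motives.ComplexPoints X.X) (2 * p))
      (fun jr : (Fin n × (T ⊕ P)) × Fin 2 => Sum.elim
        (fun τ => complexBetti.map f₁.hom.hom.hom 1 (rmLetters g b ((jr.1.1, τ), jr.2)))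
        (fun i => complexBetti.map f₂.hom.hom.hom 1 (y ((jr.1.1, i), jr.2))) jr.1.2) a ∈
      Submodule.span ℂ {z : complexBetti X.X (2 * p) | ∃ (p' r : ℕ) (h : 2 * p' + r = 2 * p)
        (dB : complexBetti B.X (2 * p')) (w : Fin r → (Fin n × P) × Fin 2),
        dB ∈ divisorClassesSpan B.X B.dim p' ∧
        z = cupProduct h (complexBetti.map f₁.hom.hom.hom (2 * p') dB)
          (complexBetti.map f₂.hom.hom.hom r (cupPowOne ℂ (Motives.ComplexPoints Z.X) r (fun t => y (w t))))} := by
  classical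
  rw [wordEval_eq_sum_wordSlice]
  refine Submodule.sum_mem _ fun U _ => ?_
  -- the two-sorted colouring of the positions and its left/right split
  set col : Fin (2 * p) → T ⊕ P := fun t => (U t).2 with hcol
  set s : Word 2 (2 * p) → ℂ := wordSlice a U with hs
  set m := Fintype.card {t // (col t).isLeft = true} with hm
  set r := Fintype.card {t // ¬ (col t).isLeft = true} with hr
  have hmr : m + r = 2 * p := card_isLeft_add_card_not_isLeft col
  -- the letters along a glued word
  have hword : ∀ {m' : ℕ} (φ : Fin (2 * p) ≃ Fin m' ⊕ Fin r) (τA : Fin m' → T) (iC : Fin r → P),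
      (∀ a', col (φ.symm (Sum.inl a')) = Sum.inl (τA a')) → (∀ b', col (φ.symm (Sum.inr b')) = Sum.inr (iC b')) →
      ∀ (ε₁ : Word 2 m') (η : Word 2 r),
      (fun t => (fun jr : (Fin n × (T ⊕ P)) × Fin 2 => Sum.elim
          (fun τ => complexBetti.map f₁.hom.hom.hom 1 (rmLetters g b ((jr.1.1, τ), jr.2)))
          (fun i => complexBetti.map f₂.hom.hom.hom 1 (y ((jr.1.1, i), jr.2))) jr.1.2) (U t, glueWord φ ε₁ η t)) =
        fun t => Sum.elim
          (fun a' => complexBetti.map f₁.hom.hom.hom 1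
            (rmLetters g b (((U (φ.symm (Sum.inl a'))).1, τA a'), ε₁ a')))
          (fun b' => complexBetti.map f₂.hom.hom.hom 1 (y (((U (φ.symm (Sum.inr b'))).1, iC b'), η b')))
          (φ t) := by
    intro m' φ τA iC hA hC ε₁ η
    funext t
    obtain ⟨w, rfl⟩ := φ.symm.surjective t
    rcases w with a' | b'
    · rw [Equiv.apply_symm_apply, Sum.elim_inl, glueWord_apply_inl]
      have h1 : (U (φ.symm (Sum.inl a'))).2 = Sum.inl (τA a') := hA a'
      simp only [h1, Sum.elim_inl]
    · rw [Equiv.apply_symm_apply, Sum.elim_inr, glueWord_apply_inr]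
      have h1 : (U (φ.symm (Sum.inr b'))).2 = Sum.inr (iC b') := hC b'
      simp only [h1, Sum.elim_inr]
  rcases Nat.even_or_odd m with ⟨p', hp'⟩ | hodd
  · -- EVEN block: `m = 2p'`
    have hcardA : Fintype.card {t // (col t).isLeft = true} = 2 * p' := by rw [← hm, hp', two_mul]
    obtain ⟨φ, τA, iC, hA, hC⟩ := exists_leftSplit col hcardA hr.symm
    have hmr' : 2 * p' + r = 2 * p := by omega
    have hCne : ∀ b' τ, col (φ.symm (Sum.inr b')) ≠ Sum.inl τ := fun b' τ h => by
      have h' := hC b'; rw [h] at h'; exact Sum.inl_ne_inr h'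
    -- block slices are killed colourwise
    have hkill : ∀ Y : Matrix (Fin 2) (Fin 2) ℂ, (∀ τ, wordDerAt ℂ (colourOp ℂ col (Sum.inl τ) Y) s = 0) →
        ∀ (η : Word 2 r) (τ : T), wordDerAt ℂ (colourOp ℂ τA τ Y) (blockSlice φ s η) = 0 := by
      intro Y h η τ
      have h1 := h τ
      rw [colourOp_inl_eq_blockFamilyAt φ col τA hA hCne τ Y] at h1
      exact (wordDerAt_blockFamilyAt_eq_zero_iff ℂ φ _ s).1 h1 η
    have hEs : ∀ (η : Word 2 r) (τ : T),
        wordDerAt ℂ (colourOp ℂ τA τ (Matrix.single 0 1 (1 : ℂ))) (blockSlice φ s η) = 0 :=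
      hkill _ (fun τ => hEa U τ)
    have hHs : ∀ (η : Word 2 r) (τ : T),
        wordDerAt ℂ (colourOp ℂ τA τ (Matrix.diagonal ![(1 : ℂ), -1])) (blockSlice φ s η) = 0 :=
      hkill _ (fun τ => hHa U τ)
    -- decompose the slice along the split and evaluate
    rw [eq_sum_glueTensor_blockSlice φ s]
    simp only [Finset.sum_apply, Finset.sum_smul]
    rw [Finset.sum_comm]
    refine Submodule.sum_mem _ fun η _ => ?_
    rw [sum_glueTensor_single_smul φ (blockSlice φ s η) η]
    -- the slot-and-place words of the two parts
    set uA : Fin (2 * p') → Fin n × T := fun a' => ((U (φ.symm (Sum.inl a'))).1, τA a') with huA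
    set uC : Fin r → Fin n × P := fun b' => ((U (φ.symm (Sum.inr b'))).1, iC b') with huC
    set sgn : ℂ := (((Equiv.Perm.sign (φ.trans (finSumFinEquiv.trans (finCongr hmr'))) : ℤˣ) : ℤ) : ℂ)
      with hsgn
    set dB : complexBetti B.X (2 * p') := ∑ ε₁ : Word 2 (2 * p'), blockSlice φ s η ε₁ •
      cupPowOneAlt ℂ (Motives.ComplexPoints B.X) (2 * p') (fun t => rmLetters g b (uA t, ε₁ t)) with hdB
    have hdBmem : dB ∈ divisorClassesSpan B.X B.dim p' :=
      sum_smul_cupPowOneAlt_rmLetters_mem_divisorClassesSpan g b hθ uA (blockSlice φ s η) (hEs η) (hHs η)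
    set μ : complexBetti Z.X r := cupPowOne ℂ (Motives.ComplexPoints Z.X) r (fun t => y (uC t, η t)) with hμ
    have hterm : ∀ ε₁ : Word 2 (2 * p'),
        cupPowOneAlt ℂ (Motives.ComplexPoints X.X) (2 * p) (fun t =>
          (fun jr : (Fin n × (T ⊕ P)) × Fin 2 => Sum.elim
            (fun τ => complexBetti.map f₁.hom.hom.hom 1 (rmLetters g b ((jr.1.1, τ), jr.2)))
            (fun i => complexBetti.map f₂.hom.hom.hom 1 (y ((jr.1.1, i), jr.2))) jr.1.2) (U t, glueWord φ ε₁ η t)) =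
        sgn • cupProduct hmr'
          (complexBetti.map f₁.hom.hom.hom (2 * p')
            (cupPowOneAlt ℂ (Motives.ComplexPoints B.X) (2 * p') (fun t => rmLetters g b (uA t, ε₁ t))))
          (complexBetti.map f₂.hom.hom.hom r μ) := by
      intro ε₁
      rw [hword φ τA iC hA hC ε₁ η, cupPowOneAlt_apply, cupPowOne_sumElim_eq_sign_smul_cupProduct ℂ φ hmr',
        cupPowOneAlt_apply, hμ, Motives.complexBetti_map_cupPowOne, Motives.complexBetti_map_cupPowOne]
    simp only [hterm]
    have hsum : ∑ ε₁ : Word 2 (2 * p'), blockSlice φ s η ε₁ • sgn • cupProduct hmr'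
        (complexBetti.map f₁.hom.hom.hom (2 * p')
          (cupPowOneAlt ℂ (Motives.ComplexPoints B.X) (2 * p') (fun t => rmLetters g b (uA t, ε₁ t))))
        (complexBetti.map f₂.hom.hom.hom r μ) =
        sgn • cupProduct hmr' (complexBetti.map f₁.hom.hom.hom (2 * p') dB) (complexBetti.map f₂.hom.hom.hom r μ) := by
      rw [hdB, map_sum, LinearMap.map_sum₂, Finset.smul_sum]
      refine Finset.sum_congr rfl fun ε₁ _ => ?_
      rw [map_smul, LinearMap.map_smul₂, smul_comm]
    rw [hsum]
    exact Submodule.smul_mem _ _ (Submodule.subset_span ⟨p', r, hmr', dB, fun t => (uC t, η t), hdBmem, rfl⟩)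
  · -- ODD block: the slice vanishes
    obtain ⟨φ, τA, iC, hA, hC⟩ := exists_leftSplit col hm.symm hr.symm
    have hCne : ∀ b' τ, col (φ.symm (Sum.inr b')) ≠ Sum.inl τ := fun b' τ h => by
      have h' := hC b'; rw [h] at h'; exact Sum.inl_ne_inr h'
    have hHs : ∀ (η : Word 2 r) (τ : T),
        wordDerAt ℂ (colourOp ℂ τA τ (Matrix.diagonal ![(1 : ℂ), -1])) (blockSlice φ s η) = 0 := by
      intro η τ
      have h1 := hHa U τ
      rw [show (fun t => (U t).2) = col from rfl, colourOp_inl_eq_blockFamilyAt φ col τA hA hCne τ] at h1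
      exact (wordDerAt_blockFamilyAt_eq_zero_iff ℂ φ _ s).1 h1 η
    have hzero : ∀ η : Word 2 r, blockSlice φ s η = 0 :=
      fun η => eq_zero_of_colourwise_diag_of_odd hodd τA (hHs η)
    have hs0 : ∀ ε, s ε = 0 := fun ε => by
      have h := congrFun (hzero (restWord φ ε)) (blockWord φ ε)
      rwa [blockSlice_apply, glueWord_blockWord_restWord, Pi.zero_apply] at h
    rw [Finset.sum_eq_zero fun ε _ => by rw [hs0 ε, zero_smul]]
    exact Submodule.zero_mem _

end Evaluation

end Literature.AlgebraicGeometry.HodgeTheory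

end
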